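import Summits.Ventures.PercRepro.Nested
import Summits.Ventures.PercRepro.LemmaC7

/-!
# The abstract Lemma C and the reduction of C-009 to it

**C-009** (`Summits.Ventures.PercRepro.Nested`, mine-3's M3-C1g): in Gladkov's abstract setting —
a product measure on a cube partitioned into cells `A = cell 0`, `B = cell 1`, `C_i = cell (i+2)`
with every `A ∪ C_i` an up-set — `e₃(μA, μB, μC₁, …, μC_m) ≤ μA · μB`.

With the (non-symmetric) kernel `kerC009 m s t w = [s = 0 ∧ t = 1] − [s < t < w]` on the cell
indices, `cubSum (kerC009 m) μ = μA · μB · (∑ μ) − e₃(μ)` for every `m` (`cubSum_kerC009`, a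
two-line structural identity), and `∑ μ = 1`.  Its symmetrisation times `6` is the `2 / −1 / 0`
kernel of `LemmaC7`/`LemmaC8` (`2` on `{A,A,B}`, `{A,B,B}`; `−1` on `{A,C_i,C_j}`, `{B,C_i,C_j}`,
`{C_i,C_j,C_l}`), and a class is invariant under permuting the three copies, so the class sums
are the same.  The three-copy sorting identity (`cubSum_law_eq_sum_tripleClass`) therefore reduces
C-009 to

**the abstract Lemma C** (`LemmaCAbstract`, conjectured): in every Gladkov setting and for every
nested triple `v ≤ m ≤ u`, the colourings of the class weighted by the kernel of the three cells
sum to a nonnegative number.  `C009_of_LemmaCAbstract` is the reduction; C-007 and C-008 are the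
percolation instances (`C007_of_LemmaC`, `C008_of_LemmaC8`).
-/

namespace PercRepro

open Finset

/-! ### The kernel and its cubic form -/

/-- The C-009 kernel on `m + 2` cell indices: `[s = 0 ∧ t = 1] − [s < t ∧ t < w]`. -/
def kerC009 (m : ℕ) (s t w : Fin (m + 2)) : ℝ :=
  (if s = 0 then (if t = 1 then 1 else 0) else 0) - (if s < t ∧ t < w then 1 else 0)

/-- `cubSum (kerC009 m) π = π 0 · π 1 · (∑ π) − e₃(π)`. -/
theorem cubSum_kerC009 {m : ℕ} (π : Fin (m + 2) → ℝ) :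
    cubSum (kerC009 m) π = π 0 * π 1 * (∑ w, π w) - e3Vec π := by
  unfold cubSum triSum kerC009 e3Vec
  simp only [sub_mul, Finset.sum_sub_distrib]
  congr 1
  · have h1 : ∀ s t w : Fin (m + 2),
        (if s = 0 then (if t = 1 then (1 : ℝ) else 0) else 0) * π s * π t * π w =
          if s = 0 then (if t = 1 then π s * π t * π w else 0) else 0 := by
      intro s t w
      split_ifs <;> simp
    simp only [h1, Finset.sum_ite_irrel, Finset.sum_const_zero, Finset.sum_ite_eq',
      Finset.mem_univ, if_true, Finset.mul_sum]
  · refine Finset.sum_congr rfl fun s _ => Finset.sum_congr rfl fun t _ =>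
      Finset.sum_congr rfl fun w _ => ?_
    split_ifs <;> simp

/-! ### The cell statistic of a Gladkov setting -/

variable {E : Type*} [Fintype E] [DecidableEq E]

section Setting

variable {m : ℕ} {cell : Fin (m + 2) → Set (Config E)}

omit [Fintype E] [DecidableEq E] in
/-- Every configuration lies in some cell. -/
theorem exists_mem_cell (hs : GladkovSetting cell) (ω : Config E) : ∃ i, ω ∈ cell i := by
  have h : ω ∈ ⋃ i, cell i := by
    rw [hs.cover]
    trivial
  exact Set.mem_iUnion.1 h

/-- The index of the cell containing `ω`. -/
noncomputable def cellOf (hs : GladkovSetting cell) (ω : Config E) : Fin (m + 2) :=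
  Classical.choose (exists_mem_cell hs ω)

omit [Fintype E] [DecidableEq E] in
/-- `ω` lies in its cell. -/
theorem mem_cell_cellOf (hs : GladkovSetting cell) (ω : Config E) : ω ∈ cell (cellOf hs ω) :=
  Classical.choose_spec (exists_mem_cell hs ω)

omit [Fintype E] [DecidableEq E] in
/-- The cell index is characterised by membership (the cells are disjoint). -/
theorem cellOf_eq_iff (hs : GladkovSetting cell) {ω : Config E} {i : Fin (m + 2)} :
    cellOf hs ω = i ↔ ω ∈ cell i := by
  constructor
  · rintro rfl
    exact mem_cell_cellOf hs ω
  · intro h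
    by_contra hne
    exact Set.disjoint_left.1 (hs.disjoint hne) (mem_cell_cellOf hs ω) h

omit [Fintype E] [DecidableEq E] in
/-- The fibres of `cellOf` are the cells. -/
theorem preimage_cellOf (hs : GladkovSetting cell) (i : Fin (m + 2)) :
    cellOf hs ⁻¹' {i} = cell i := by
  ext ω
  rw [Set.mem_preimage, Set.mem_singleton_iff, cellOf_eq_iff hs]

/-- The cell probabilities sum to `1`. -/
theorem sum_prob_cell (hs : GladkovSetting cell) (p : E → ℝ) : ∑ i, prob p (cell i) = 1 := by
  rw [← sum_prob_fiber p (cellOf hs)]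
  exact Finset.sum_congr rfl fun i _ => by rw [preimage_cellOf hs]

end Setting

/-! ### The abstract Lemma C and C-009 -/

/-- **The abstract Lemma C** (conjectured): in every Gladkov setting and for every nested triple
`v ≤ m ≤ u`, the colourings `φ : u ∖ v → {0,1,2}` of the class, weighted by the kernel
`kerC009` of the cells of the three copies, sum to a nonnegative number. -/
def LemmaCAbstract : Prop :=
  ∀ {E : Type} [Fintype E] [DecidableEq E] (m : ℕ) (cell : Fin (m + 2) → Set (Config E))
    (hs : GladkovSetting cell) (u m' v : Config E), v ≤ m' → m' ≤ u →
      0 ≤ ∑ φ : ↥(openEdges u \ openEdges v) → Fin 3,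
        kerC009 m (cellOf hs (tripleCopy v m' (openEdges u \ openEdges v) φ 0))
          (cellOf hs (tripleCopy v m' (openEdges u \ openEdges v) φ 1))
          (cellOf hs (tripleCopy v m' (openEdges u \ openEdges v) φ 2))

/-- **C-009 follows from the abstract Lemma C** (the three-copy sorting identity). -/
theorem C009_of_LemmaCAbstract (h : LemmaCAbstract) : C009 := by
  intro E _ _ p hp m cell hs
  have hcls : ∀ u m' v : Config E, 0 ≤ ∑ x ∈ tripleClass u m' v,
      kerC009 m (cellOf hs x.1) (cellOf hs x.2.1) (cellOf hs x.2.2) := by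
    intro u m' v
    by_cases hn : v ≤ m' ∧ m' ≤ u
    · have h' := sum_tripleClass_eq_sum_colourings hn.1 hn.2
        (fun x y z => kerC009 m (cellOf hs x) (cellOf hs y) (cellOf hs z))
      rw [h']
      exact h m cell hs u m' v hn.1 hn.2
    · rw [tripleClass_eq_empty_of_not_le hn, Finset.sum_empty]
  have key := cubSum_law_nonneg_of_classes hp (cellOf hs) (kerC009 m) hcls
  have hlaw : (fun s => prob p (cellOf hs ⁻¹' {s})) = fun i => prob p (cell i) := by
    funext i
    rw [preimage_cellOf hs]
  rw [hlaw, cubSum_kerC009, sum_prob_cell hs p, mul_one] at key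
  linarith

end PercRepro
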